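import Summits.ResolutionOfSingularities.ResolutionOfSingularities.Theorems.FrobeniusLadderFRationalResolutionTowerStep
import Mathlib.Algebra.MonoidAlgebra.Basic
import Mathlib.RingTheory.FiniteType
import HarnessLib

/-!
# Toric surface programme: the unimodular substitution `θ(m₁,m₂) = (m₂, d m₂ − m₁)` carries `U(a,a′)` onto the `xy`-chart

Support file for crux stmt-ResolutionOfSingularities-15317 (`FrobeniusLadder.FRationalResolution`),
line `redirect`, lead c4 (toric surface programme for rung 4′: all affine toric surfaces
`U(r,a) = Spec k[{m ∈ ℤ² : 0 ≤ m₂, a m₂ ≤ r m₁}]` over every field are resolved by the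
Hirzebruch–Jung tower of two-chart monomial blow-ups).

This file: the RECURSIVE CHART of one step of the tower. For `1 ≤ a < r`, `d = ⌈r/a⌉`,
`a′ = d a − r` (only the relation `a′ + r = d a` is used), the lattice automorphism
`θ(m₁, m₂) = (m₂, d m₂ − m₁)` of `ℤ²` (inverse `(n₁, n₂) ↦ (d n₁ − n₂, n₁)`, determinant `1`) maps
the dual-cone lattice points `σS[a, a′] = {0 ≤ n₂, a′ n₂ ≤ a n₁}` bijectively onto
`S₂ = {0 ≤ m₁, a m₂ ≤ r m₁}`, the exponent set of the `xy`-chart of `Bl_{(x, xy)} U(r, a)`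
(for `m = θ n`: `0 ≤ m₁ ⇔ 0 ≤ n₂` and `a m₂ ≤ r m₁ ⇔ a (d n₂ − n₁) ≤ r n₂ ⇔ (d a − r) n₂ ≤ a n₁
⇔ a′ n₂ ≤ a n₁`). Hence the induced `k`-algebra automorphism
`Θ = AddMonoidAlgebra.domCongr k k θ` of the torus algebra `Lk = k[ℤ²]` (`Θ χᵐ = χ^(θ m)`,
`AddMonoidAlgebra.domCongr_single`) carries the toric algebra `TA[a, a′]` onto the monomial
algebra of `S₂` (`AlgHom.map_adjoin`, `Set.image_image`).

* `toric_theta_mem` / `toric_theta_symm_mem` — `θ` maps `σS[a, a′]` into `S₂` and `θ⁻¹` maps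
  `S₂` into `σS[a, a′]` (pure `ℤ`-arithmetic from `a′ + r = d a`);
* `stub_toric_theta` — the registered stub.

All folklore (Cox–Little–Schenck 2011 §10.1–10.2; Fulton 1993 §2.6); no published fact is used.
-/

-- single-problem summit: the doubled namespace component is forced
set_option linter.dupNamespace false

noncomputable section

namespace Summit.ResolutionOfSingularities.ResolutionOfSingularities.Theorems.FRationalResolution

open CategoryTheory AlgebraicGeometry TopologicalSpace
open Literature.AlgebraicGeometry.Resolution

section Toric

variable (k : Type) [Field k]

/-- The Laurent polynomial ring `k[ℤ²]` (coordinate ring of the 2-torus). -/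
local notation3 "Lk" => AddMonoidAlgebra k (ℤ × ℤ)

/-- The lattice points of the dual cone `σ∨ = {m₂ ≥ 0, a m₂ ≤ r m₁}` of `σ = cone((0,1),(r,-a))`. -/
local notation3 "σS[" r ", " a "]" =>
  {m : ℤ × ℤ | 0 ≤ m.2 ∧ ((a : ℕ) : ℤ) * m.2 ≤ ((r : ℕ) : ℤ) * m.1}

/-- The toric surface algebra `k[σ∨ ∩ ℤ²] ⊆ k[ℤ²]`. -/
local notation3 "TA[" r ", " a "]" =>
  Algebra.adjoin k ((fun m : ℤ × ℤ => AddMonoidAlgebra.single m (1 : k)) '' σS[r, a])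

/-- `θ(n) = (n₂, d n₂ − n₁)` maps `σS[a, a′] = {0 ≤ n₂, a′ n₂ ≤ a n₁}` into
`S₂ = {0 ≤ m₁, a m₂ ≤ r m₁}` when `a′ + r = d a`:
`a (d n₂ − n₁) = (a′ + r) n₂ − a n₁ ≤ r n₂`. [folklore] -/
theorem toric_theta_mem (r a d a' : ℕ) (hda : a' + r = d * a) (n : ℤ × ℤ)
    (hn : 0 ≤ n.2 ∧ ((a' : ℕ) : ℤ) * n.2 ≤ ((a : ℕ) : ℤ) * n.1) :
    0 ≤ (n.2, (d : ℤ) * n.2 - n.1).1 ∧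
      ((a : ℕ) : ℤ) * (n.2, (d : ℤ) * n.2 - n.1).2 ≤ ((r : ℕ) : ℤ) * (n.2, (d : ℤ) * n.2 - n.1).1 := by
  have hda' : ((a' : ℕ) : ℤ) + r = d * a := by exact_mod_cast hda
  refine ⟨hn.1, ?_⟩
  dsimp only
  linear_combination hn.2 - n.2 * hda'

/-- `θ⁻¹(m) = (d m₁ − m₂, m₁)` maps `S₂ = {0 ≤ m₁, a m₂ ≤ r m₁}` into
`σS[a, a′] = {0 ≤ n₂, a′ n₂ ≤ a n₁}` when `a′ + r = d a`:
`a′ m₁ = (d a − r) m₁ ≤ d a m₁ − a m₂ = a (d m₁ − m₂)`. [folklore] -/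
theorem toric_theta_symm_mem (r a d a' : ℕ) (hda : a' + r = d * a) (m : ℤ × ℤ)
    (hm : 0 ≤ m.1 ∧ ((a : ℕ) : ℤ) * m.2 ≤ ((r : ℕ) : ℤ) * m.1) :
    0 ≤ ((d : ℤ) * m.1 - m.2, m.1).2 ∧
      ((a' : ℕ) : ℤ) * ((d : ℤ) * m.1 - m.2, m.1).2 ≤ ((a : ℕ) : ℤ) * ((d : ℤ) * m.1 - m.2, m.1).1 := by
  have hda' : ((a' : ℕ) : ℤ) + r = d * a := by exact_mod_cast hda
  refine ⟨hm.1, ?_⟩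
  dsimp only
  linear_combination hm.2 + m.1 * hda'

/-- The unimodular substitution `θ(m₁, m₂) = (m₂, d m₂ − m₁)` of `ℤ²` induces a `k`-algebra
automorphism `Θ = AddMonoidAlgebra.domCongr k k θ` of the torus algebra `Lk` with
`Θ χᵐ = χ^(θ m)`, and `Θ` carries `TA[a, a′]` (`a′ + r = d a`) onto the `k`-subalgebra generated
by the monomials of `{0 ≤ m₁, a m₂ ≤ r m₁}` — the `xy`-chart of `Bl_{(x, xy)} U(r, a)` is
`U(a, a′)`. [folklore; CLS2011 §10.2] -/
theorem stub_toric_theta (r a d a' : ℕ) (ha : 1 ≤ a) (hda : a' + r = d * a) (ha'a : a' < a) :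
    ∃ Θ : Lk ≃ₐ[k] Lk,
      (∀ m : ℤ × ℤ, Θ (AddMonoidAlgebra.single m 1) =
        AddMonoidAlgebra.single (m.2, (d : ℤ) * m.2 - m.1) 1) ∧
      Subalgebra.map Θ.toAlgHom TA[a, a'] =
        Algebra.adjoin k ((fun m : ℤ × ℤ => AddMonoidAlgebra.single m (1 : k)) ''
          {m : ℤ × ℤ | 0 ≤ m.1 ∧ ((a : ℕ) : ℤ) * m.2 ≤ ((r : ℕ) : ℤ) * m.1}) := by
  have _ := ha
  have _ := ha'a
  -- the lattice automorphism `θ` with its explicit inverse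
  obtain ⟨θ, hθ⟩ : ∃ θ : ℤ × ℤ ≃+ ℤ × ℤ, ∀ m, θ m = (m.2, (d : ℤ) * m.2 - m.1) :=
    ⟨{ toFun := fun m => (m.2, (d : ℤ) * m.2 - m.1)
       invFun := fun n => ((d : ℤ) * n.1 - n.2, n.1)
       left_inv := fun m => Prod.ext (by dsimp only; ring) rfl
       right_inv := fun n => Prod.ext rfl (by dsimp only; ring)
       map_add' := fun m n => Prod.ext rfl (by dsimp only [Prod.fst_add, Prod.snd_add]; ring) },
      fun _ => rfl⟩
  refine ⟨AddMonoidAlgebra.domCongr k k θ, fun m => ?_, ?_⟩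
  · rw [AddMonoidAlgebra.domCongr_single, hθ]
  · rw [AlgHom.map_adjoin, Set.image_image]
    congr 1
    ext x
    simp only [Set.mem_image, Set.mem_setOf_eq, AlgEquiv.toAlgHom_apply,
      AddMonoidAlgebra.domCongr_single]
    constructor
    · rintro ⟨n, hn, rfl⟩
      exact ⟨θ n, (hθ n).symm ▸ toric_theta_mem r a d a' hda n hn, rfl⟩
    · rintro ⟨m, hm, rfl⟩
      refine ⟨((d : ℤ) * m.1 - m.2, m.1), toric_theta_symm_mem r a d a' hda m hm, ?_⟩
      rw [hθ]
      congr 1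
      exact Prod.ext rfl (by dsimp only; ring)

end Toric

end Summit.ResolutionOfSingularities.ResolutionOfSingularities.Theorems.FRationalResolution

end
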